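import Summits.ABC.StewartYu.KummerThirdDoor
import Literature.Barriers.ABC.BakerMethodBoundsLinearPlaceBoundsProofs
import HarnessLib

/-!
# Cell abc-stewartyu, M3 (rung F-A1 = Stewart–Yu 2001, exponent 1/3): the LINEAR Kummer door — cell-side adapters
# for the D-m0 fallback split `Y07Odd ⇐ Y07OddLin ∧ Y07OddHi` (insurance; `--supports stmt-ABC-19658`)

`Summits/ABC/StewartYu/KummerThirdLin.lean` — cell `abc-stewartyu` (lit seat g8 on the route holder's assignment, plan g8
2026-08-27T03:34Z; one predicate `Y07AtLin` + theorems, no named fact).  Twin of `KummerThirdPlaceBound.lean` /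
`KummerThirdDoor.lean` (seat p3) with the `p`-adic place factor `p / log p` of the Yu-2007-quality texts replaced by the
LINEAR factor `p` — the shape the cell's landed `v1` slab record delivers at every odd prime (planner's fallback spec
`HOME/plan/m3/split/LinDoorSpec.lean`, signatures verbatim):

THIS FILE:
* `Y07AtLin C p` — the linear place text at one prime (`Y07At` with `(p / log p)` replaced by `p`), `y07AtLin_mono`;
* `y07AtLin_of_y07At : 1 ≤ C → Y07At C p → Y07AtLin (2C) p` (`1 / log p < 2`);
* `placeBound_a_of_y07AtLin` — the linear place bound `ν_p(a) log p < Θ^{(max 4 C)}_{bc} · p (log p + Y)` (p ∣ a), same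
  book-keeping as p3's `placeBound_a_of_y07At` (`S`, `e_q`, `B`, `log p + log B + log log A ≤ 4(log p + Y)`,
  `4 C^{#S} ≤ K^{#S+1}`), place factor carried.
SEQUEL `KummerThirdLinDoor.lean`: `placeBound_c_of_y07AtLin` (p ∣ c, ab > 1), `y07AtLin_of_oddLin_two` (merge of a LINEAR
odd-`p` text with the strong `p = 2` text `Y07Two`), and **`BakerMethodBounds_of_y07Lin : ⟨Y07OddLin⟩ → ⟨Y07Two⟩ →
BakerMethodBounds`** through lit's linear door `Literature.Barriers.ABC.BakerMethodBounds_of_placeBoundsLin_kummerArchBound₂`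
and the tree's archimedean input `waldschmidt1980_hW₂`.

Everything is elementary book-keeping [cite: StewartYu2001, §3]; the texts themselves are NOT proved here.

## References

* [StewartYu2001] C. L. Stewart, K. Yu, *On the abc conjecture, II*, Duke Math. J. 108 (2001), 169–181 — §3.
-/

noncomputable section

open Finset Real Height
open Literature.NumberTheory.DiophantineGeometry
open Literature.NumberTheory.DiophantineGeometry.Dioph
open Literature.NumberTheory.DiophantineGeometry.Pasten
open Literature.NumberTheory.Transcendental.Waldschmidt1980

namespace Summit.ABC.StewartYu.KummerThird

open Literature.Barriers.ABC

section PrimesDoorLin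

variable {a b c : ℕ}

/-! ### The linear place text -/

/-- The LINEAR place text at one prime: `Y07At` with the place factor `(p / log p)` replaced by `p` (the shape of the
cell's `v1` slab record at every odd prime; planner's fallback spec `LinDoorSpec`). [cite: StewartYu2001, §3 (shape only)] -/
def Y07AtLin (C : ℝ) (p : ℕ) : Prop :=
  ∀ (S : Finset ℕ), (∀ q ∈ S, q.Prime) → p ∉ S → S.Nonempty → ∀ (e : ℕ → ℤ) (B : ℝ), 3 ≤ B →
    (∀ q ∈ S, (|e q| : ℝ) ≤ B) → ∏ q ∈ S, (q : ℚ) ^ e q ≠ 1 →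
    (padicValRat p (∏ q ∈ S, (q : ℚ) ^ e q - 1) : ℝ) * Real.log p <
      C ^ S.card * (p : ℝ) *
        (Real.log p + Real.log B + Real.log (Real.log ((max 4 (S.sup id) : ℕ) : ℝ))) *
        ∏ q ∈ S, Real.log (q : ℝ)

/-- Unfolding lemma for `Y07AtLin`. [folklore] -/
theorem y07AtLin_iff (C : ℝ) (p : ℕ) : Y07AtLin C p ↔
    ∀ (S : Finset ℕ), (∀ q ∈ S, q.Prime) → p ∉ S → S.Nonempty → ∀ (e : ℕ → ℤ) (B : ℝ), 3 ≤ B →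
    (∀ q ∈ S, (|e q| : ℝ) ≤ B) → ∏ q ∈ S, (q : ℚ) ^ e q ≠ 1 →
    (padicValRat p (∏ q ∈ S, (q : ℚ) ^ e q - 1) : ℝ) * Real.log p <
      C ^ S.card * (p : ℝ) *
        (Real.log p + Real.log B + Real.log (Real.log ((max 4 (S.sup id) : ℕ) : ℝ))) *
        ∏ q ∈ S, Real.log (q : ℝ) := Iff.rfl

/-- The three non-negative factors of the texts at a prime `p`: `0 ≤ log p + log B + log log A` (`B ≥ 3`, `A ≥ 4`)
and `0 ≤ ∏_{q ∈ S} log q`. [folklore] -/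
private theorem text_factors_nonneg {p : ℕ} (hp : p.Prime) {S : Finset ℕ} (hS : ∀ q ∈ S, q.Prime) {B : ℝ}
    (hB : 3 ≤ B) :
    0 ≤ Real.log p + Real.log B + Real.log (Real.log ((max 4 (S.sup id) : ℕ) : ℝ)) ∧
      0 ≤ ∏ q ∈ S, Real.log (q : ℝ) := by
  have hp1 : (1 : ℝ) < p := by exact_mod_cast hp.one_lt
  have hlp : 0 < Real.log p := Real.log_pos hp1
  have hB3 : 0 ≤ Real.log B := Real.log_nonneg (by linarith)
  have hA : 0 ≤ Real.log (Real.log ((max 4 (S.sup id) : ℕ) : ℝ)) := by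
    apply Real.log_nonneg
    have h4 : (4 : ℝ) ≤ ((max 4 (S.sup id) : ℕ) : ℝ) := by exact_mod_cast le_max_left _ _
    rw [← Real.log_exp 1]
    refine Real.log_le_log (Real.exp_pos 1) (le_trans ?_ h4)
    have := Real.exp_one_lt_d9; linarith
  exact ⟨by linarith, Finset.prod_nonneg fun q hq => Real.log_nonneg (by exact_mod_cast (hS q hq).one_lt.le)⟩

/-- The linear text is monotone in the constant for `|C| ≤ C'`. [folklore] -/
theorem y07AtLin_mono {C C' : ℝ} (hCC' : |C| ≤ C') {p : ℕ} (hp : p.Prime) (h : Y07AtLin C p) :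
    Y07AtLin C' p := by
  intro S hS hpS hne e B hB heB hne1
  have h0 := h S hS hpS hne e B hB heB hne1
  obtain ⟨hL, hP⟩ := text_factors_nonneg hp hS hB
  have hpl : (0 : ℝ) ≤ (p : ℝ) := Nat.cast_nonneg p
  have hpow : C ^ S.card ≤ C' ^ S.card :=
    (le_abs_self _).trans (by rw [abs_pow]; exact pow_le_pow_left₀ (abs_nonneg C) hCC' _)
  refine h0.trans_le ?_
  exact mul_le_mul_of_nonneg_right (mul_le_mul_of_nonneg_right (mul_le_mul_of_nonneg_right hpow hpl) hL) hP

/-- **`Y07At C p → Y07AtLin (2C) p` for `C ≥ 1`**: `p / log p ≤ 2p` since `log p ≥ log 2 > 1/2`, and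
`2 C^{#S} ≤ (2C)^{#S}` since `#S ≥ 1`. [folklore] -/
theorem y07AtLin_of_y07At {C : ℝ} (hC0 : 1 ≤ C) {p : ℕ} (hp : p.Prime) (h : Y07At C p) :
    Y07AtLin (2 * C) p := by
  intro S hS hpS hne e B hB heB hne1
  have h0 := h S hS hpS hne e B hB heB hne1
  obtain ⟨hL, hP⟩ := text_factors_nonneg hp hS hB
  have hlog2 : (1 / 2 : ℝ) < Real.log 2 := by have := Real.log_two_gt_d9; linarith
  have hlogp : Real.log 2 ≤ Real.log p := Real.log_le_log two_pos (by exact_mod_cast hp.two_le)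
  have hlp : 0 < Real.log p := by linarith
  have hp0 : (0 : ℝ) ≤ p := Nat.cast_nonneg p
  have hdiv : (p : ℝ) / Real.log p ≤ 2 * p := by
    rw [div_le_iff₀ hlp]; nlinarith
  have hcard : 1 ≤ S.card := Finset.card_pos.mpr hne
  have hC0' : 0 ≤ C := zero_le_one.trans hC0
  have hpow : C ^ S.card * 2 ≤ (2 * C) ^ S.card := by
    rw [mul_pow]
    have h2 : (2 : ℝ) ≤ 2 ^ S.card := by
      calc (2 : ℝ) = 2 ^ 1 := by norm_num
        _ ≤ 2 ^ S.card := pow_le_pow_right₀ (by norm_num) hcard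
    calc C ^ S.card * 2 = 2 * C ^ S.card := mul_comm _ _
      _ ≤ 2 ^ S.card * C ^ S.card := mul_le_mul_of_nonneg_right h2 (pow_nonneg hC0' _)
  refine h0.trans_le ?_
  calc C ^ S.card * ((p : ℝ) / Real.log p) *
        (Real.log p + Real.log B + Real.log (Real.log ((max 4 (S.sup id) : ℕ) : ℝ))) *
        ∏ q ∈ S, Real.log (q : ℝ)
      ≤ C ^ S.card * (2 * p) *
        (Real.log p + Real.log B + Real.log (Real.log ((max 4 (S.sup id) : ℕ) : ℝ))) *
        ∏ q ∈ S, Real.log (q : ℝ) := by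
        apply mul_le_mul_of_nonneg_right _ hP
        apply mul_le_mul_of_nonneg_right _ hL
        exact mul_le_mul_of_nonneg_left hdiv (pow_nonneg hC0' _)
    _ = (C ^ S.card * 2) * (p : ℝ) *
        (Real.log p + Real.log B + Real.log (Real.log ((max 4 (S.sup id) : ℕ) : ℝ))) *
        ∏ q ∈ S, Real.log (q : ℝ) := by ring
    _ ≤ (2 * C) ^ S.card * (p : ℝ) *
        (Real.log p + Real.log B + Real.log (Real.log ((max 4 (S.sup id) : ℕ) : ℝ))) *
        ∏ q ∈ S, Real.log (q : ℝ) := by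
        apply mul_le_mul_of_nonneg_right _ hP
        apply mul_le_mul_of_nonneg_right _ hL
        exact mul_le_mul_of_nonneg_right hpow hp0

/-! ### The two linear place bounds from the linear text -/

/-- **The linear place bound at `p ∣ a`** from the linear text at `p` (constant `C ≥ 0`): for an abc triple `(a, b, c)`
and a prime `p ∣ a`, `ν_p(a) log p < theta (max 4 C) b c 0 · (p (log p + log max{e, 2 log c}))` — `S` = the primes of
`bc`, `e_q = ν_q(b) − ν_q(c)`, `∏ q^{e_q} − 1 = b/c − 1 = −a/c` (twin of `placeBound_a_of_y07At`, place factor carried).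
[cite: StewartYu2001, §3] -/
theorem placeBound_a_of_y07AtLin {C : ℝ} (hC0 : 0 ≤ C) (h : IsABCTriple a b c) {p : ℕ} (hp : p.Prime)
    (hY : Y07AtLin C p) (hpa : p ∣ a) :
    (a.factorization p : ℝ) * Real.log p < theta (max 4 C) b c 0 *
      ((p : ℝ) * (Real.log p + Real.log (max (Real.exp 1) (2 * Real.log c)))) := by
  classical
  obtain ⟨ha, hb, habc, hcop⟩ := id h
  have hc2 : 2 ≤ c := h.two_le
  have hc : 0 < c := by omega
  have hbc : b.Coprime c := coprime_right_of_isABCTriple h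
  have hac : a.Coprime c := coprime_left_of_isABCTriple h
  set S := (b * c).primeFactors with hSdef
  set Y := Real.log (max (Real.exp 1) (2 * Real.log c)) with hYdef
  have hY1 : 1 ≤ Y := one_le_log_max_exp _
  have hS : ∀ q ∈ S, q.Prime := fun q hq => Nat.prime_of_mem_primeFactors hq
  have hbc0 : b * c ≠ 0 := by positivity
  have hpS : p ∉ S := by
    intro hpS'
    have hpbc : p ∣ b * c := Nat.dvd_of_mem_primeFactors hpS'
    rcases (Nat.Prime.dvd_mul hp).mp hpbc with hpb | hpc
    · exact hp.one_lt.ne' (Nat.dvd_one.mp (hcop.gcd_eq_one ▸ Nat.dvd_gcd hpa hpb))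
    · exact hp.one_lt.ne' (Nat.dvd_one.mp (hac.gcd_eq_one ▸ Nat.dvd_gcd hpa hpc))
  have hSne : S.Nonempty := by
    rw [hSdef, Nat.nonempty_primeFactors]; nlinarith
  -- exponents and their bound
  set e : ℕ → ℤ := fun q => expDiff b c q with hedef
  set B : ℝ := max 3 (3 * Real.log c) with hBdef
  have hB3 : (3 : ℝ) ≤ B := le_max_left _ _
  have hlogc : 0 ≤ Real.log c := Real.log_nonneg (by exact_mod_cast hc)
  have heB : ∀ q ∈ S, (|e q| : ℝ) ≤ B := by
    intro q hq
    have hq := hS q hq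
    have h1 : (|e q| : ℝ) ≤ (b.factorization q : ℝ) + (c.factorization q : ℝ) := by
      simp only [hedef, expDiff]
      push_cast
      refine (abs_sub (b.factorization q : ℝ) (c.factorization q : ℝ)).trans (le_of_eq ?_)
      rw [abs_of_nonneg (by positivity), abs_of_nonneg (by positivity)]
    have h2 := factorization_le_log_c (c := c) hb.ne' hq (by omega)
    have h3 := factorization_le_log_c (c := c) hc.ne' hq le_rfl
    exact h1.trans ((add_le_add h2 h3).trans (by rw [hBdef]; linarith [le_max_right (3 : ℝ) (3 * Real.log c)]))
  -- the product is `b/c`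
  have hprod : ∏ q ∈ S, (q : ℚ) ^ e q = (b : ℚ) / c := (cast_div_eq_prod_zpow hb.ne' hc.ne' hbc).symm
  have hc' : (c : ℚ) ≠ 0 := by exact_mod_cast hc.ne'
  have hne1 : ∏ q ∈ S, (q : ℚ) ^ e q ≠ 1 := by
    rw [hprod, Ne, div_eq_one_iff_eq hc']; exact_mod_cast (show b ≠ c by omega)
  -- the text
  have key := hY S hS hpS hSne e B hB3 heB hne1
  -- `ord_p(b/c − 1) = ν_p(a)`
  have hsub : ∏ q ∈ S, (q : ℚ) ^ e q - 1 = -((a : ℚ) / c) := by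
    rw [hprod]
    field_simp
    exact_mod_cast (show (b : ℤ) - c = -a by omega)
  have hpc : ¬p ∣ c := fun hpc =>
    hp.one_lt.ne' (Nat.dvd_one.mp (hac.gcd_eq_one ▸ Nat.dvd_gcd hpa hpc))
  have hval : padicValRat p (∏ q ∈ S, (q : ℚ) ^ e q - 1) = a.factorization p := by
    haveI : Fact p.Prime := ⟨hp⟩
    rw [hsub, padicValRat.neg, padicValRat.div (by exact_mod_cast ha.ne') hc', padicValRat.of_nat,
      padicValRat.of_nat, padicValNat.eq_zero_of_not_dvd hpc, Nat.factorization_def a hp]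
    simp
  rw [hval, Int.cast_natCast] at key
  -- compare the right-hand sides
  have hp1 : (1 : ℝ) < p := by exact_mod_cast hp.one_lt
  have hlp : 0 < Real.log p := Real.log_pos hp1
  have hl2 : Real.log 2 ≤ Real.log p := Real.log_le_log two_pos (by exact_mod_cast hp.two_le)
  have hlog2 := Real.log_two_gt_d9
  have hpl : (0 : ℝ) ≤ (p : ℝ) := Nat.cast_nonneg p
  have hP : 0 ≤ ∏ q ∈ S, Real.log (q : ℝ) :=
    Finset.prod_nonneg fun q hq => Real.log_nonneg (by exact_mod_cast (hS q hq).one_lt.le)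
  -- `log B ≤ log (3/2) + Y ≤ 1/2 + Y`
  have hlogB : Real.log B ≤ 1 / 2 + Y := by
    have hM : B ≤ (3 / 2) * max (Real.exp 1) (2 * Real.log c) := by
      rw [hBdef]; refine max_le ?_ ?_
      · have := Real.exp_one_gt_d9
        have : (3 : ℝ) ≤ 3 / 2 * Real.exp 1 := by linarith
        exact this.trans (by gcongr; exact le_max_left _ _)
      · calc 3 * Real.log c = 3 / 2 * (2 * Real.log c) := by ring
          _ ≤ 3 / 2 * max (Real.exp 1) (2 * Real.log c) := by gcongr; exact le_max_right _ _
    have hM0 : 0 < max (Real.exp 1) (2 * Real.log c) := lt_of_lt_of_le (Real.exp_pos 1) (le_max_left _ _)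
    have h32 : Real.log (3 / 2 : ℝ) ≤ 1 / 2 := by
      have := Real.log_le_sub_one_of_pos (show (0 : ℝ) < 3 / 2 by norm_num); linarith
    calc Real.log B ≤ Real.log ((3 / 2) * max (Real.exp 1) (2 * Real.log c)) :=
          Real.log_le_log (by linarith) hM
      _ = Real.log (3 / 2) + Y := by rw [Real.log_mul (by norm_num) hM0.ne']
      _ ≤ 1 / 2 + Y := by linarith
  -- `log log A ≤ log 2 + Y`
  have hllA : Real.log (Real.log ((max 4 (S.sup id) : ℕ) : ℝ)) ≤ Real.log 2 + Y := by
    refine loglog_le_of_le_four_mul_sq (c := c) (by exact_mod_cast le_max_left _ _) hc2 ?_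
    exact cast_max_four_sup_le (by nlinarith) hc2
  have hlog2' := Real.log_two_lt_d9
  have hsum : Real.log p + Real.log B + Real.log (Real.log ((max 4 (S.sup id) : ℕ) : ℝ)) ≤
      4 * (Real.log p + Y) := by linarith
  -- `C^n · 4 ≤ K^{n+1}`
  set K : ℝ := max 4 C with hKdef
  have hK4 : (4 : ℝ) ≤ K := le_max_left _ _
  have hCK : C ≤ K := le_max_right _ _
  have hpowK : C ^ S.card * 4 ≤ K ^ (S.card + 1) := by
    rw [pow_succ]
    exact mul_le_mul (pow_le_pow_left₀ hC0 hCK _) hK4 (by norm_num) (by positivity)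
  have hθ : theta K b c 0 = K ^ (S.card + 1) * ∏ q ∈ S, Real.log (q : ℝ) := by
    rw [theta_zero_eq K hb.ne' hc.ne' hbc]
  rw [hθ]
  set PL := ∏ q ∈ S, Real.log (q : ℝ) with hPL
  have hLY : 0 ≤ Real.log p + Y := by linarith
  calc (a.factorization p : ℝ) * Real.log p
      < C ^ S.card * (p : ℝ) *
          (Real.log p + Real.log B + Real.log (Real.log ((max 4 (S.sup id) : ℕ) : ℝ))) * PL := key
    _ ≤ C ^ S.card * (p : ℝ) * (4 * (Real.log p + Y)) * PL := by
        have h0 : 0 ≤ C ^ S.card * (p : ℝ) := mul_nonneg (pow_nonneg hC0 _) hpl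
        exact mul_le_mul_of_nonneg_right (mul_le_mul_of_nonneg_left hsum h0) hP
    _ = (C ^ S.card * 4) * (PL * ((p : ℝ) * (Real.log p + Y))) := by ring
    _ ≤ K ^ (S.card + 1) * (PL * ((p : ℝ) * (Real.log p + Y))) := by
        have h0 : 0 ≤ PL * ((p : ℝ) * (Real.log p + Y)) := by positivity
        exact mul_le_mul_of_nonneg_right hpowK h0
    _ = K ^ (S.card + 1) * PL * ((p : ℝ) * (Real.log p + Y)) := by ring


end PrimesDoorLin

end Summit.ABC.StewartYu.KummerThird

end
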